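import Mathlib
import Summits.ValiantsHypothesis.ValiantsHypothesis.Theorems.NewtonTauWeak.Negative.Zonogon

/-!
# `NewtonTauWeak` (stmt-ValiantsHypothesis-5904), line `binomial-normal-form`: the common-exponent step

Support file for the crux
`Summit.ValiantsHypothesis.ValiantsHypothesis.Theses.NewtonUnitEquations.NewtonTauWeak`
(KPTT arXiv:1308.2286, Conjecture 1 in the weak form of their Theorem 1: the number `vert` of Newton
vertices of `Σ_{i<k} Π_{j<m} f_ij` for `t`-sparse bivariate `f_ij` over `ℂ` is `≤ 2^{a m}(k t+2)^b`).

This file proves the registered stub `stub_commonStep` of the skeleton line `binomial-normal-form`, the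
cheap normalisation "WLOG all `K` products of binomials use ONE common exponent list": the COMMON-EXPONENT
binomial bound with exponent `b`,
`vert(Σ_{l<K} c_l Π_{j<N} (1 - ρ_{lj} X^{d_j})) ≤ (K N+2)^b` for one exponent list `d : Fin N → ℕ²`,
implies the FREE-EXPONENT binomial bound with exponent `2b`,
`vert(Σ_{l<K} c_l Π_{j<N} (1 - ρ_{lj} X^{d_{lj}})) ≤ (K N+2)^{2b}` for exponents `d : Fin K → Fin N → ℕ²`.
Proof: concatenate the `K` exponent lists into one list of length `K N` (`Fin (K N) ≃ Fin K × Fin N`,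
`finProdFinEquiv`) and pad the `l`-th product with `ρ = 0` factors over the other `K - 1` blocks; every
padded factor is `1 - C 0 · X^d = 1`, so the `l`-th product is unchanged (`CommonStep.prod_pad`), the two sums
coincide termwise, and the hypothesis at `(K, K N)` gives `vert ≤ (K (K N)+2)^b ≤ ((K N+2)^2)^b = (K N+2)^{2b}`
(`CommonStep.pow_le_pow_two_mul`: `K² N ≤ K² N²` as `N ≤ N²`). The degenerate cases `K = 0`, `N = 0` need no
separate treatment.

Helper lemmas live in the sub-namespace `CommonStep`; nothing here is a definition or a named fact.

References: P. Koiran, N. Portier, S. Tavenas, S. Thomassé, *A τ-conjecture for Newton polygons*,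
arXiv:1308.2286 (FoCM 15 (2015)), §2 (the binomial / `t = 2` layer of Conjecture 1); the reduction itself is
bookkeeping [folklore].
-/

-- the namespace mandated for this Theorems file repeats the component `ValiantsHypothesis`
set_option linter.dupNamespace false

noncomputable section

open scoped BigOperators
open MvPolynomial
open Summit.ValiantsHypothesis.ValiantsHypothesis.Theorems.NewtonTauWeak.Negative
  (vert vert_le_card_support)

namespace Summit.ValiantsHypothesis.ValiantsHypothesis.Theorems.NewtonUnitEquationsNewtonTauWeak

namespace CommonStep

/-- Padding a product of binomials: over the index set `Fin K × Fin N`, the product of the binomials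
`1 - C (if l' = l then ρ_j else 0) · X^{d_{l' j}}` is the product over the block `l' = l` alone,
`Π_{j<N} (1 - C ρ_j · X^{d_{l j}})`, since every factor of a block `l' ≠ l` is `1 - C 0 · X^{d} = 1`.
[folklore] -/
theorem prod_pad {K N : ℕ} (l : Fin K) (ρ : Fin N → ℂ) (d : Fin K → Fin N → (Fin 2 →₀ ℕ)) :
    ∏ p : Fin K × Fin N,
        (1 - C (if p.1 = l then ρ p.2 else 0) * monomial (d p.1 p.2) 1 : MvPolynomial (Fin 2) ℂ) =
      ∏ j, (1 - C (ρ j) * monomial (d l j) 1) := by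
  rw [Fintype.prod_prod_type]
  rw [Fintype.prod_eq_single (f := fun l' : Fin K => ∏ j : Fin N,
      (1 - C (if l' = l then ρ j else 0) * monomial (d l' j) 1 : MvPolynomial (Fin 2) ℂ)) l
    fun l' hl' => by simp [hl']]
  simp

/-- The arithmetic of the constants: `(K (K N)+2)^b ≤ (K N+2)^{2b}`, from
`K (K N) + 2 ≤ (K N)^2 + 4 ≤ (K N+2)^2` (as `N ≤ N^2`). [folklore] -/
theorem pow_le_pow_two_mul (K N b : ℕ) : (K * (K * N) + 2) ^ b ≤ (K * N + 2) ^ (2 * b) := by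
  rw [pow_mul]
  apply Nat.pow_le_pow_left
  have h1 : K * (K * N) ≤ K * N * (K * N) :=
    calc K * (K * N) = K * K * N := (mul_assoc K K N).symm
      _ ≤ K * K * (N * N) := Nat.mul_le_mul_left _ (Nat.le_mul_self N)
      _ = K * N * (K * N) := by ring
  calc K * (K * N) + 2 ≤ K * N * (K * N) + 4 := Nat.add_le_add h1 (by norm_num)
    _ ≤ K * N * (K * N) + 4 + 4 * (K * N) := Nat.le_add_right _ _
    _ = (K * N + 2) ^ 2 := by ring

end CommonStep

/-- **STUB `stub_commonStep` of line `binomial-normal-form` (common-exponent step).** The common-exponent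
binomial bound with exponent `b` — `vert(Σ_{l<K} c_l Π_{j<N} (1 - ρ_{lj} X^{d_j})) ≤ (K N+2)^b` for ONE
exponent list `d : Fin N → ℕ²` shared by all `K` products (`ρ_{lj} = 0` allowed) — gives the free-exponent
binomial bound with exponent `2b`: `vert(Σ_{l<K} c_l Π_{j<N} (1 - ρ_{lj} X^{d_{lj}})) ≤ (K N+2)^{2b}`.
Proof: with `e : Fin (K N) ≃ Fin K × Fin N` put `d' i := d (e i).1 (e i).2` and
`ρ' l i := if (e i).1 = l then ρ l (e i).2 else 0`; then `Π_i (1 - C (ρ' l i) X^{d' i}) = Π_j (1 - C (ρ l j) X^{d l j})`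
for every `l` (reindex along `e`, the blocks `l' ≠ l` contribute `1`: `CommonStep.prod_pad`), so the two sums are
equal and the hypothesis at `(K, K N, c, ρ', d')` gives `vert ≤ (K (K N)+2)^b ≤ (K N+2)^{2b}`
(`CommonStep.pow_le_pow_two_mul`). [folklore; KPTT arXiv:1308.2286 §2 for the binomial layer] -/
theorem stub_commonStep (b : ℕ)
    (h : ∀ (K N : ℕ) (c : Fin K → ℂ) (ρ : Fin K → Fin N → ℂ) (d : Fin N → (Fin 2 →₀ ℕ)),
      vert (∑ l, C (c l) * ∏ j, (1 - C (ρ l j) * monomial (d j) 1)) ≤ (K * N + 2) ^ b)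
    (K N : ℕ) (c : Fin K → ℂ) (ρ : Fin K → Fin N → ℂ) (d : Fin K → Fin N → (Fin 2 →₀ ℕ)) :
    vert (∑ l, C (c l) * ∏ j, (1 - C (ρ l j) * monomial (d l j) 1)) ≤ (K * N + 2) ^ (2 * b) := by
  -- concatenate the `K` exponent lists: `Fin (K * N) ≃ Fin K × Fin N`
  obtain ⟨e⟩ : Nonempty (Fin (K * N) ≃ Fin K × Fin N) := ⟨finProdFinEquiv.symm⟩
  calc vert (∑ l, C (c l) * ∏ j, (1 - C (ρ l j) * monomial (d l j) 1))
      = vert (∑ l, C (c l) * ∏ i,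
          (1 - C (if (e i).1 = l then ρ l (e i).2 else 0) * monomial (d (e i).1 (e i).2) 1)) :=
        -- every product, padded with `ρ = 0` factors over the other blocks, is a product over the
        -- concatenated list
        congrArg vert <| Finset.sum_congr rfl fun l _ => congrArg (C (c l) * ·) <|
          ((e.prod_comp fun p : Fin K × Fin N =>
              (1 - C (if p.1 = l then ρ l p.2 else 0) * monomial (d p.1 p.2) 1 :
                MvPolynomial (Fin 2) ℂ)).trans
            (CommonStep.prod_pad l (ρ l) d)).symm
    _ ≤ (K * (K * N) + 2) ^ b :=
        h K (K * N) c (fun l i => if (e i).1 = l then ρ l (e i).2 else 0) fun i => d (e i).1 (e i).2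
    _ ≤ (K * N + 2) ^ (2 * b) := CommonStep.pow_le_pow_two_mul K N b

end Summit.ValiantsHypothesis.ValiantsHypothesis.Theorems.NewtonUnitEquationsNewtonTauWeak

end
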